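import Mathlib
import Summits.NavierStokesRegularity.NavierStokesRegularity.Theorems.FilamentSkeletonRssAreaLawSlavingGrowth

/-!
# Area-law slaving, part 4 — the Γ-FLAT CONE BOUND `Rw²Γ·Aa ≤ KA·(Rw²Γ + ‖X‖²)` with `KA` chosen BEFORE `Γ`
# (`FilamentSkeletonRss`, child crux `TangentSkeletonNearStraight`, stmt-NavierStokesRegularity-28295, line
# `child_tangent_analytic_strip`, ∃-side of the registered stub `stub_analyticClosing`, step (v))

The last conjunct of the flat clause block `FlatJ1G` is the Γ-flat cone bound `∀ j τ, Rw^2*Γ*Aa j τ ≤ KA*(Rw^2*Γ+‖X j τ‖^2)`,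
and in the crux `TangentSkeletonNearStraight` the constant `KA` is chosen BEFORE the tolerance `Rb` and the circulation `Γ`
(`∃ (δ ρ K Λ Rw cg θ₀ KA Rb₁), … ∀ Rb, … ∃ Γ₂, ∀ Γ ≥ Γ₂, ∃ (X w c Aa), FlatJ1G …`).  This file shows that the SLAVED area of part 3
meets that letter with a Γ-FREE `KA` as soon as the slip hypotheses are imposed in WAIST SCALING — supercritical core window
`|τ − c| ≤ σ₀√Γ`, far barrier `|τ−c|/2 − c₀√Γ ≤ |w|` beyond `σ₁√Γ` (the similarity drift `½⟪y, X′⟫` of the datum's closed-form slip,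
whose partner and rotation terms are `O(√Γ)`), slip floor `m|τ−c| ≤ |w|`, slope bound `|w′| ≤ Λ` — together with the ESCAPE clause
`cg|τ − c_j| ≤ Rw√Γ + ‖X_j τ‖` of `FlatJ1G`:

* `cone_of_quadratic` — bookkeeping: `A ≤ P + Q(τ−c)²` and escape give `Rw²Γ·A ≤ (P + 2QΓRw²/cg²)·(Rw²Γ + ‖X τ‖²)`;
* `arm_bound_scaled` — part 3's `areaLaw_arm_bound` at `S₀ = σ₀√Γ`, `S₁ = σ₁√Γ`, `C₀ = c₀√Γ` reads `A ≤ 4/δ + A_II + (Q₀/Γ)(τ−c)²`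
  with `A_II = (4Λ/δ + 8m/3)e^{3(σ₁−σ₀)/(2mσ₀)}/m`, `Q₀ = (Λσ₁A_II/(σ₁/2−c₀)³ + 4/(σ₁/2−c₀)²)/4`, both Γ-free;
* `areaLaw_cone_bound` — HEADLINE, in the crux's quantifier order: `∃ KA > 0` (depending on `δ Λ m σ₀ σ₁ c₀ cg Rw` only) such that
  for EVERY `Γ > 0` and every `(w, A, c, X)` satisfying the area law and the scaled slip/escape hypotheses,
  `∀ τ, Rw^2*Γ*A τ ≤ KA*(Rw^2*Γ+‖X τ‖^2)` — `KA = 4/δ + A_II + 2Q₀Rw²/cg²`.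

HONEST FRAMING: bookkeeping for a HYPOTHETICAL filament skeleton on the NEGATIVE side of a MODEL route (A1G aside); nothing
here bears on Navier–Stokes regularity or blow-up, and no registered stub is closed by this file.
`--supports stmt-NavierStokesRegularity-28295`.
-/

set_option linter.dupNamespace false

noncomputable section

namespace Summit.NavierStokesRegularity.NavierStokesRegularity.Theorems.AreaLawSlaving

open Set Real

/-! ## §1 From quadratic growth and escape to the cone letter -/

/-- **Cone bookkeeping.**  If `A τ ≤ P + Q(τ−c)²` (`P, Q ≥ 0`) and the escape clause `cg|τ−c| ≤ Rw√Γ + ‖X τ‖` holds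
(`cg > 0`, `Γ ≥ 0`), then `Rw²Γ·A τ ≤ (P + 2QΓRw²/cg²)·(Rw²Γ + ‖X τ‖²)`. [folklore] -/
theorem cone_of_quadratic {A : ℝ → ℝ} {X : ℝ → EuclideanSpace ℝ (Fin 3)} {c P Q cg Rw Γ : ℝ}
    (hP : 0 ≤ P) (hQ : 0 ≤ Q) (hcg : 0 < cg) (hΓ : 0 ≤ Γ)
    (hA : ∀ τ, A τ ≤ P + Q * (τ - c) ^ 2) (hesc : ∀ τ, cg * |τ - c| ≤ Rw * √Γ + ‖X τ‖) (τ : ℝ) :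
    Rw ^ 2 * Γ * A τ ≤ (P + 2 * Q * Γ * Rw ^ 2 / cg ^ 2) * (Rw ^ 2 * Γ + ‖X τ‖ ^ 2) := by
  have hsq : cg ^ 2 * (τ - c) ^ 2 ≤ 2 * (Rw ^ 2 * Γ + ‖X τ‖ ^ 2) := by
    have h1 := hesc τ
    have h0 : 0 ≤ cg * |τ - c| := mul_nonneg hcg.le (abs_nonneg _)
    have h2 : (cg * |τ - c|) ^ 2 ≤ (Rw * √Γ + ‖X τ‖) ^ 2 := pow_le_pow_left₀ h0 h1 2
    have h3 : (Rw * √Γ + ‖X τ‖) ^ 2 ≤ 2 * ((Rw * √Γ) ^ 2 + ‖X τ‖ ^ 2) := by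
      nlinarith [sq_nonneg (Rw * √Γ - ‖X τ‖)]
    have h4 : (Rw * √Γ) ^ 2 = Rw ^ 2 * Γ := by rw [mul_pow, Real.sq_sqrt hΓ]
    rw [mul_pow, sq_abs] at h2
    rw [h4] at h3
    linarith
  have hτc : (τ - c) ^ 2 ≤ 2 * (Rw ^ 2 * Γ + ‖X τ‖ ^ 2) / cg ^ 2 := by
    rw [le_div_iff₀ (pow_pos hcg 2)]; linarith
  have hW : 0 ≤ Rw ^ 2 * Γ + ‖X τ‖ ^ 2 := by positivity
  have hRΓ : 0 ≤ Rw ^ 2 * Γ := by positivity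
  have hA' : A τ ≤ P + Q * (2 * (Rw ^ 2 * Γ + ‖X τ‖ ^ 2) / cg ^ 2) :=
    (hA τ).trans (by nlinarith [mul_le_mul_of_nonneg_left hτc hQ])
  calc Rw ^ 2 * Γ * A τ ≤ Rw ^ 2 * Γ * (P + Q * (2 * (Rw ^ 2 * Γ + ‖X τ‖ ^ 2) / cg ^ 2)) :=
        mul_le_mul_of_nonneg_left hA' hRΓ
    _ = P * (Rw ^ 2 * Γ) + (2 * Q * Γ * Rw ^ 2 / cg ^ 2) * (Rw ^ 2 * Γ + ‖X τ‖ ^ 2) := by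
        field_simp
    _ ≤ P * (Rw ^ 2 * Γ + ‖X τ‖ ^ 2) + (2 * Q * Γ * Rw ^ 2 / cg ^ 2) * (Rw ^ 2 * Γ + ‖X τ‖ ^ 2) := by
        have : P * (Rw ^ 2 * Γ) ≤ P * (Rw ^ 2 * Γ + ‖X τ‖ ^ 2) :=
          mul_le_mul_of_nonneg_left (by nlinarith [sq_nonneg ‖X τ‖]) hP
        linarith
    _ = (P + 2 * Q * Γ * Rw ^ 2 / cg ^ 2) * (Rw ^ 2 * Γ + ‖X τ‖ ^ 2) := by ring

/-! ## §2 The arm bound in waist scaling -/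

/-- **Scaled arm bound.**  Part 3's `areaLaw_arm_bound` with `S₀ = σ₀√Γ`, `S₁ = σ₁√Γ`, `C₀ = c₀√Γ` (`Γ > 0`):
`A τ ≤ 4/δ + A_II + (Q₀/Γ)·(τ − c)²` with the Γ-FREE constants
`A_II = (4Λ/δ + 8m/3)·exp(3(σ₁−σ₀)/(2mσ₀))/m`, `Q₀ = (Λσ₁A_II/(σ₁/2−c₀)³ + 4/(σ₁/2−c₀)²)/4`. [folklore] -/
theorem arm_bound_scaled {w A : ℝ → ℝ} (hw : Differentiable ℝ w) (hA : Differentiable ℝ A)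
    (hlaw : ∀ τ, w τ * deriv A τ = (3 / 2 - deriv w τ) * A τ + 4) (hpos : ∀ τ, 0 < A τ) {c : ℝ} (hc : w c = 0)
    {δ σ₀ σ₁ Λ m c₀ Γ : ℝ} (hΓ : 0 < Γ) (hδ : 0 < δ) (hσ₀ : 0 < σ₀) (hσ₁ : σ₀ ≤ σ₁) (hm : 0 < m) (hc₀ : 0 ≤ c₀)
    (hu : 0 < σ₁ / 2 - c₀)
    (hsup : ∀ s, |s - c| ≤ σ₀ * √Γ → 3 / 2 + δ ≤ deriv w s) (hΛ : ∀ τ, |deriv w τ| ≤ Λ)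
    (hfloor : ∀ τ, m * |τ - c| ≤ |w τ|) (hfar : ∀ τ, σ₁ * √Γ ≤ |τ - c| → |τ - c| / 2 - c₀ * √Γ ≤ |w τ|) (τ : ℝ) :
    A τ ≤ 4 / δ + (4 * Λ / δ + 8 * m / 3) * Real.exp (3 * (σ₁ - σ₀) / (2 * m * σ₀)) / m +
      (Λ * σ₁ * ((4 * Λ / δ + 8 * m / 3) * Real.exp (3 * (σ₁ - σ₀) / (2 * m * σ₀)) / m) / (σ₁ / 2 - c₀) ^ 3 +
        4 / (σ₁ / 2 - c₀) ^ 2) / 4 / Γ * (τ - c) ^ 2 := by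
  have hsq : 0 < √Γ := Real.sqrt_pos.2 hΓ
  have hS₀ : 0 < σ₀ * √Γ := mul_pos hσ₀ hsq
  have hS₁ : σ₀ * √Γ ≤ σ₁ * √Γ := mul_le_mul_of_nonneg_right hσ₁ hsq.le
  have hC₀ : 0 ≤ c₀ * √Γ := mul_nonneg hc₀ hsq.le
  have hu₁ : 0 < σ₁ * √Γ / 2 - c₀ * √Γ := by
    have : σ₁ * √Γ / 2 - c₀ * √Γ = (σ₁ / 2 - c₀) * √Γ := by ring
    rw [this]; exact mul_pos hu hsq
  have h := areaLaw_arm_bound hw hA hlaw hpos hc hδ hS₀ hS₁ hm hC₀ hu₁ hsup hΛ hfloor hfar τ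
  -- rewrite the constants: the exponent and the quadratic coefficient are Γ-free up to the factor 1/Γ
  have hexp : 3 * (σ₁ * √Γ - σ₀ * √Γ) / (2 * m * (σ₀ * √Γ)) = 3 * (σ₁ - σ₀) / (2 * m * σ₀) := by
    field_simp
  have hsq2 : (√Γ) ^ 2 = Γ := Real.sq_sqrt hΓ.le
  have hsq3 : (√Γ) ^ 3 = Γ * √Γ := by rw [pow_succ, hsq2]
  have hu2 : (σ₁ * √Γ / 2 - c₀ * √Γ) ^ 2 = (σ₁ / 2 - c₀) ^ 2 * Γ := by
    rw [show σ₁ * √Γ / 2 - c₀ * √Γ = (σ₁ / 2 - c₀) * √Γ by ring, mul_pow, hsq2]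
  have hu3 : (σ₁ * √Γ / 2 - c₀ * √Γ) ^ 3 = (σ₁ / 2 - c₀) ^ 3 * (Γ * √Γ) := by
    rw [show σ₁ * √Γ / 2 - c₀ * √Γ = (σ₁ / 2 - c₀) * √Γ by ring, mul_pow, hsq3]
  rw [hexp, hu2, hu3] at h
  set AII : ℝ := (4 * Λ / δ + 8 * m / 3) * Real.exp (3 * (σ₁ - σ₀) / (2 * m * σ₀)) / m with hAII
  have hcoef : (Λ * (σ₁ * √Γ) * AII / ((σ₁ / 2 - c₀) ^ 3 * (Γ * √Γ)) + 4 / ((σ₁ / 2 - c₀) ^ 2 * Γ)) / 4 =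
      (Λ * σ₁ * AII / (σ₁ / 2 - c₀) ^ 3 + 4 / (σ₁ / 2 - c₀) ^ 2) / 4 / Γ := by
    have hune : σ₁ / 2 - c₀ ≠ 0 := hu.ne'
    field_simp
  rw [hcoef] at h
  exact h

/-! ## §3 The cone bound with `KA` chosen before `Γ` -/

/-- **AREA-LAW SLAVING ⇒ Γ-FLAT CONE BOUND** (headline, in the quantifier order of the crux `TangentSkeletonNearStraight`):
for constants `δ, σ₀, m, cg > 0`, `σ₀ ≤ σ₁`, `0 ≤ c₀ < σ₁/2`, `Λ ≥ 0`, `Rw`, there is `KA > 0` — EXPLICITLY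
`KA = 4/δ + A_II + 2Q₀Rw²/cg²` — such that for EVERY `Γ > 0` and every slip/area/centre/curve `(w, A, c, X)` with the area law,
`A > 0`, `w(c) = 0`, the supercritical core window `w′ ≥ 3/2 + δ` on `|τ−c| ≤ σ₀√Γ`, `|w′| ≤ Λ`, the slip floor `m|τ−c| ≤ |w|`,
the far barrier `|τ−c|/2 − c₀√Γ ≤ |w|` beyond `σ₁√Γ` and the escape clause `cg|τ−c| ≤ Rw√Γ + ‖X τ‖`:
`∀ τ, Rw^2*Γ*A τ ≤ KA*(Rw^2*Γ+‖X τ‖^2)` — the LETTER of the last conjunct of `FlatJ1G`. [folklore] -/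
theorem areaLaw_cone_bound {δ σ₀ σ₁ Λ m c₀ cg Rw : ℝ} (hδ : 0 < δ) (hσ₀ : 0 < σ₀) (hσ₁ : σ₀ ≤ σ₁) (hm : 0 < m)
    (hc₀ : 0 ≤ c₀) (hu : 0 < σ₁ / 2 - c₀) (hΛ0 : 0 ≤ Λ) (hcg : 0 < cg) :
    ∃ KA : ℝ, 0 < KA ∧ ∀ Γ : ℝ, 0 < Γ →
      ∀ (w A : ℝ → ℝ) (c : ℝ) (X : ℝ → EuclideanSpace ℝ (Fin 3)),
        Differentiable ℝ w → Differentiable ℝ A →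
        (∀ τ, w τ * deriv A τ = (3 / 2 - deriv w τ) * A τ + 4) → (∀ τ, 0 < A τ) → w c = 0 →
        (∀ s, |s - c| ≤ σ₀ * √Γ → 3 / 2 + δ ≤ deriv w s) → (∀ τ, |deriv w τ| ≤ Λ) →
        (∀ τ, m * |τ - c| ≤ |w τ|) → (∀ τ, σ₁ * √Γ ≤ |τ - c| → |τ - c| / 2 - c₀ * √Γ ≤ |w τ|) →
        (∀ τ, cg * |τ - c| ≤ Rw * √Γ + ‖X τ‖) →
        ∀ τ, Rw ^ 2 * Γ * A τ ≤ KA * (Rw ^ 2 * Γ + ‖X τ‖ ^ 2) := by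
  set AII : ℝ := (4 * Λ / δ + 8 * m / 3) * Real.exp (3 * (σ₁ - σ₀) / (2 * m * σ₀)) / m with hAII
  set Q₀ : ℝ := (Λ * σ₁ * AII / (σ₁ / 2 - c₀) ^ 3 + 4 / (σ₁ / 2 - c₀) ^ 2) / 4 with hQ₀
  have hAII0 : 0 ≤ AII := by rw [hAII]; positivity
  have hσ₁0 : 0 ≤ σ₁ := hσ₀.le.trans hσ₁
  have hQ₀0 : 0 ≤ Q₀ := by
    rw [hQ₀]
    apply div_nonneg _ (by norm_num)
    exact add_nonneg (div_nonneg (by positivity) (pow_pos hu 3).le) (div_nonneg (by norm_num) (pow_pos hu 2).le)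
  refine ⟨4 / δ + AII + 2 * Q₀ * Rw ^ 2 / cg ^ 2, by positivity, ?_⟩
  intro Γ hΓ w A c X hw hA hlaw hpos hc hsup hΛ hfloor hfar hesc τ
  have harm : ∀ x, A x ≤ (4 / δ + AII) + Q₀ / Γ * (x - c) ^ 2 := by
    intro x
    have h := arm_bound_scaled hw hA hlaw hpos hc hΓ hδ hσ₀ hσ₁ hm hc₀ hu hsup hΛ hfloor hfar x
    rw [← hAII] at h
    have : (Λ * σ₁ * AII / (σ₁ / 2 - c₀) ^ 3 + 4 / (σ₁ / 2 - c₀) ^ 2) / 4 / Γ = Q₀ / Γ := by rw [hQ₀]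
    rw [this] at h
    linarith
  have hP : 0 ≤ 4 / δ + AII := by positivity
  have hcone := cone_of_quadratic (X := X) hP (div_nonneg hQ₀0 hΓ.le) hcg hΓ.le harm hesc τ
  have hK : 4 / δ + AII + 2 * (Q₀ / Γ) * Γ * Rw ^ 2 / cg ^ 2 = 4 / δ + AII + 2 * Q₀ * Rw ^ 2 / cg ^ 2 := by
    field_simp
  rw [hK] at hcone
  exact hcone

end Summit.NavierStokesRegularity.NavierStokesRegularity.Theorems.AreaLawSlaving

end
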